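import Summits.MatrixMultiplication.MatrixMultiplication.Theses.SnSubsetDichotomy
import Summits.MatrixMultiplication.MatrixMultiplication.Theorems.SnSubsetDichotomyGlobalBranchStubTruncatedCount
import Summits.MatrixMultiplication.MatrixMultiplication.Theorems.SnSubsetDichotomyGlobalBranchStubDimGrowth
import Summits.MatrixMultiplication.MatrixMultiplication.Theorems.SnSubsetDichotomyGlobalBranchStubFlatCase

/-!
# The incoherent case of `GlobalBranch` (crux stmt-MatrixMultiplication-8303; lines flat-tail-truncation / young-host-squeeze)

Crux `Summit.MatrixMultiplication.MatrixMultiplication.Theses.SnSubsetDichotomy.GlobalBranch`.  From the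
landed two-ended level-`L` truncation of the BCGPU identity for `𝔖ₙ` (`stub_truncatedCount`: for every
TPP triple, `V² ≤ n!·V + (n!)^{3/2}·V/√D + V²·Λ_L`, `Λ_L = Σ_{ℓ=1}^{L} n^{(ℓ)}(sM ℓ S·sM ℓ T·sM ℓ U +
sT ℓ S·sT ℓ T·sT ℓ U)` the low-level COHERENCE WEIGHT of the triple, `D` any lower bound for the degrees
`f^μ` of two-ended level `> L`) and the landed dimension growth beyond level `⌊√n⌋` (`stub_dimGrowth`:
`f^μ ≥ e^{c√n}`), we prove the **incoherent case**: for some absolute `c > 0` and all large `n`, every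
TPP triple whose coherence weight `Λ_{⌊√n⌋}` is at most `1/2` satisfies `|S||T||U| ≤ (n!)^{3/2} e^{-c√n}`
(`incoherent_subthreshold`).  No flatness of the individual sets is required (the flat case
`stub_flatCase` is the special case `Λ ≤ 2/7` forced by per-set flatness); only the TRIPLE products of
the spectral masses enter.  The spectral masses `sM`, `sT` enter as pinned function parameters (their
defining equations are hypotheses), exactly as in `stub_flatCase`.

Arithmetic: with `E := e^{c'√n/4} ≥ 4`, `D := e^{c'√n}` (`√D = E²`), `R := √(n!) ≥ 4E`:
`V² ≤ FV + FRV/E² + V²/2` gives `V E ≤ F R` (`incoherent_arith_core`), i.e. `V ≤ (n!)^{3/2} e^{-c'√n/4}`.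
-/

set_option linter.dupNamespace false

open scoped BigOperators
open Finset

namespace Summit.MatrixMultiplication.MatrixMultiplication.Theorems.GlobalBranch

open Literature.Combinatorics.Additive (TripleProductProperty)
open Literature.NumberTheory.DiophantineGeometry (numStandardTableaux spechtCharacter)

/-- Real-variable core of the incoherent case: from `V² ≤ F V + F R V / E² + V² Λ`, `Λ ≤ 1/2`,
`R ≥ 4E`, `E ≥ 4` conclude `V E ≤ F R`. [folklore] -/
theorem incoherent_arith_core {V Λ F E R : ℝ} (hV : 0 ≤ V) (hΛ : Λ ≤ 1 / 2) (hF0 : 0 < F)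
    (hE4 : 4 ≤ E) (hR0 : 0 < R) (hRE : 4 * E ≤ R)
    (h : V ^ 2 ≤ F * V + F * R * V / E ^ 2 + V ^ 2 * Λ) : V * E ≤ F * R := by
  have hE0 : 0 < E := by linarith
  -- 2E² + 2R ≤ R E
  have key : 2 * E ^ 2 + 2 * R ≤ R * E := by
    nlinarith [mul_nonneg (sub_nonneg.2 hRE) (by linarith : (0 : ℝ) ≤ E - 2),
      mul_nonneg hE0.le (by linarith : (0 : ℝ) ≤ E - 4)]
  rcases hV.eq_or_lt with hV0 | hVpos
  · rw [← hV0, zero_mul]; positivity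
  · have hdiv : V ≤ F + F * R / E ^ 2 + V * Λ := by
      have h1 : V * V ≤ V * (F + F * R / E ^ 2 + V * Λ) := by
        have hr : V * (F + F * R / E ^ 2 + V * Λ) = F * V + F * R * V / E ^ 2 + V ^ 2 * Λ := by
          ring
        rw [hr, ← sq]; exact h
      exact le_of_mul_le_mul_left h1 hVpos
    have hhalf : 1 / 2 * V ≤ F + F * R / E ^ 2 := by
      nlinarith [mul_le_mul_of_nonneg_left hΛ hV]
    have hE2 : 0 < E ^ 2 := by positivity
    have hhalf' : 1 / 2 * V * E ^ 2 ≤ F * E ^ 2 + F * R := by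
      have h2 := mul_le_mul_of_nonneg_right hhalf hE2.le
      rwa [add_mul, div_mul_cancel₀ _ hE2.ne'] at h2
    have hkeyF : F * E ^ 2 + F * R ≤ 1 / 2 * (F * R * E) := by
      nlinarith [mul_le_mul_of_nonneg_left key hF0.le]
    have h3 : 1 / 2 * V * E ^ 2 ≤ 1 / 2 * (F * R * E) := hhalf'.trans hkeyF
    have h4 : (V * E) * (1 / 2 * E) ≤ (F * R) * (1 / 2 * E) := by nlinarith [h3]
    exact le_of_mul_le_mul_right h4 (by positivity)

/-- **The incoherent case of `GlobalBranch`**: for some absolute `c > 0` and all large `n`, every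
triple `S, T, U ⊆ 𝔖ₙ` with the triple product property whose low-level coherence weight
`Σ_{ℓ=1}^{⌊√n⌋} n^{(ℓ)}·(sM ℓ S·sM ℓ T·sM ℓ U + sT ℓ S·sT ℓ T·sT ℓ U)` is at most `1/2` — where
`sM ℓ X` (`sT ℓ X`) is the Hilbert–Schmidt mass `|X|⁻² Σ_μ Σ_{x,y∈X} Re χ^μ(x⁻¹y)` of `1̂_X` on the
irreducibles with first row (first column) `n - ℓ` — satisfies `|S||T||U| ≤ (n!)^{3/2} e^{-c√n}`.
Proved from the landed `stub_truncatedCount` and `stub_dimGrowth` (line flat-tail-truncation). -/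
theorem incoherent_subthreshold :
    ∃ c : ℝ, 0 < c ∧ ∃ n₂ : ℕ, ∀ n ≥ n₂,
      ∀ (sM sT : ℕ → Finset (Equiv.Perm (Fin n)) → ℝ),
      (∀ (ℓ : ℕ) (X : Finset (Equiv.Perm (Fin n))), sM ℓ X =
        (∑ μ ∈ univ.filter (fun μ : Nat.Partition n =>
            μ ≠ Nat.Partition.indiscrete n ∧ μ.parts.sup = n - ℓ),
          ∑ x ∈ X, ∑ y ∈ X, (spechtCharacter ℂ μ (x⁻¹ * y)).re) / ((X.card : ℝ) ^ 2)) →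
      (∀ (ℓ : ℕ) (X : Finset (Equiv.Perm (Fin n))), sT ℓ X =
        (∑ μ ∈ univ.filter (fun μ : Nat.Partition n =>
            μ ≠ Nat.Partition.indiscrete n ∧ Multiset.card μ.parts = n - ℓ),
          ∑ x ∈ X, ∑ y ∈ X, (spechtCharacter ℂ μ (x⁻¹ * y)).re) / ((X.card : ℝ) ^ 2)) →
      ∀ S T U : Finset (Equiv.Perm (Fin n)), TripleProductProperty S T U →
      (∑ ℓ ∈ Finset.Ico 1 (Nat.sqrt n + 1), (n.descFactorial ℓ : ℝ) *
          (sM ℓ S * sM ℓ T * sM ℓ U + sT ℓ S * sT ℓ T * sT ℓ U) ≤ 1 / 2) →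
      ((S.card * T.card * U.card : ℕ) : ℝ) ≤
        (n.factorial : ℝ) ^ ((3 : ℝ) / 2) * Real.exp (-(c * Real.sqrt (n : ℝ))) := by
  obtain ⟨c, hc, n₁, hdim⟩ := stub_dimGrowth
  -- work with c' = min c 4
  set c' : ℝ := min c 4 with hc'
  have hc'0 : 0 < c' := lt_min hc (by norm_num)
  have hc'c : c' ≤ c := min_le_left _ _
  have hc'4 : c' ≤ 4 := min_le_right _ _
  obtain ⟨N, hN⟩ := exists_nat_gt ((12 / c') ^ 2)
  refine ⟨c' / 4, by positivity, max n₁ (max 8 N), ?_⟩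
  intro n hn sM sT hsM hsT S T U hTPP hΛ
  have hn₁ : n₁ ≤ n := le_trans (le_max_left _ _) hn
  have hn8 : 8 ≤ n := le_trans (le_trans (le_max_left _ _) (le_max_right _ _)) hn
  have hnN : N ≤ n := le_trans (le_trans (le_max_right _ _) (le_max_right _ _)) hn
  have hn1 : 1 ≤ n := le_trans (by norm_num) hn8
  -- the square root of n is large
  have hsqrt : 12 / c' ≤ Real.sqrt (n : ℝ) := by
    rw [Real.le_sqrt (by positivity) (by positivity)]
    have : ((12 / c') ^ 2 : ℝ) ≤ N := hN.le
    exact this.trans (by exact_mod_cast hnN)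
  set s : ℝ := Real.sqrt (n : ℝ) with hs
  have hs0 : 0 ≤ s := Real.sqrt_nonneg _
  set D : ℝ := Real.exp (c' * s) with hDdef
  set E : ℝ := Real.exp (c' * s / 4) with hEdef
  have hD0 : 0 < D := Real.exp_pos _
  have hE0 : 0 < E := Real.exp_pos _
  have hE4 : 4 ≤ E := by
    have h3 : 3 ≤ c' * s / 4 := by
      have := mul_le_mul_of_nonneg_left hsqrt hc'0.le
      rw [mul_div_cancel₀ _ hc'0.ne'] at this
      linarith
    have := Real.add_one_le_exp (c' * s / 4)
    rw [hEdef]; linarith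
  have hsqrtD : Real.sqrt D = E ^ 2 := by
    rw [hDdef, hEdef, ← Real.exp_nat_mul, Real.sqrt_eq_rpow, ← Real.exp_mul]
    congr 1; push_cast; ring
  have hdimD : ∀ μ : Nat.Partition n,
      Nat.sqrt n < n - max μ.parts.sup (Multiset.card μ.parts) → D ≤ (numStandardTableaux μ : ℝ) := by
    intro μ hμ
    refine le_trans ?_ (hdim n hn₁ μ hμ)
    rw [hDdef]
    exact Real.exp_le_exp.2 (mul_le_mul_of_nonneg_right hc'c hs0)
  have hcount := stub_truncatedCount n (Nat.sqrt n) hn1 D hD0 hdimD sM sT hsM hsT S T U hTPP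
  have hF0 : (0 : ℝ) < n.factorial := by exact_mod_cast n.factorial_pos
  set F : ℝ := (n.factorial : ℝ) with hFdef
  set R : ℝ := Real.sqrt F with hRdef
  have hR0 : 0 < R := Real.sqrt_pos.2 hF0
  have h32 : F ^ ((3 : ℝ) / 2) = F * R := by
    rw [show (3 : ℝ) / 2 = 1 + 1 / 2 by norm_num, Real.rpow_add hF0, Real.rpow_one, hRdef,
      Real.sqrt_eq_rpow]
  have hRE : 4 * E ≤ R := by
    have hE2 : E ^ 2 ≤ Real.exp s ^ 2 := by
      rw [hEdef, ← Real.exp_nat_mul, ← Real.exp_nat_mul, Real.exp_le_exp]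
      push_cast
      nlinarith [mul_le_mul_of_nonneg_right hc'4 hs0]
    have h16 : 16 * E ^ 2 ≤ F :=
      le_trans (by nlinarith [hE2]) (flatCase_sixteen_exp_le_factorial n hn8)
    rw [hRdef, Real.le_sqrt (by positivity) hF0.le]
    nlinarith [h16]
  have hV : (0 : ℝ) ≤ ((S.card * T.card * U.card : ℕ) : ℝ) := Nat.cast_nonneg _
  rw [h32, hsqrtD] at hcount
  have hmain := incoherent_arith_core hV hΛ hF0 hE4 hR0 hRE hcount
  rw [h32, show -(c' / 4 * s) = -(c' * s / 4) by ring, Real.exp_neg, ← hEdef, ← div_eq_mul_inv,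
    le_div_iff₀ hE0]
  exact hmain

end Summit.MatrixMultiplication.MatrixMultiplication.Theorems.GlobalBranch
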